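import Mathlib
import Literature.Geometry.Lorentzian.KerrSchild
import Literature.Geometry.Lorentzian.BoundedGeometry

/-!
# Route PhotonSphereChannels · crux `TameCensorship` (stmt-FinalStateConjecture-17431) · line `Sketch`, skeleton v5 ·
# stub `stub_pinNondegenerate`: quantitative non-degeneracy of a chart metric under the `C⁰ ≤ ½` pin

Helper file (`--supports stmt-FinalStateConjecture-17431`) of line `Sketch` (lead c2, 2026-08-17), a brick of the
PANCAKE LAW (alternative route to clause (a) of K3, skeleton v5). Clause (ii) of K3 pins the chart metric
`G = Ψ^* g` of a tame chart to the Minkowski form, `‖G − η‖ ≤ ½` (operator norm of `E4 →L[ℝ] E4 →L[ℝ] ℝ`,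
`E4 = EuclideanSpace ℝ (Fin 4)`, `η = Minkowski.bilin`). This file proves the quantitative non-degeneracy
`‖w‖ ≤ 2 ‖G(w, ·)‖`, the index-raising estimate that turns bounds on `G(Γ(X, Y), ·)` (Koszul formula) and on the
covariant curvature into bounds on the Christoffel map and the curvature endomorphism. Pure linear algebra on `E4`.

References: B. O'Neill, *Semi-Riemannian Geometry* (1983), Ch. 2, Lemma 2.24 ff.
-/

set_option linter.dupNamespace false

open Literature.Geometry.Lorentzian

noncomputable section

namespace Summit.FinalStateConjecture.FinalStateConjecture.Theorems.PhotonSphereChannels.TameCensorshipUnwind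

/-- Pointwise form of the operator-norm pin: `|G(v, w) − η(v, w)| ≤ ‖G − η‖ ‖v‖ ‖w‖ ≤ ½ ‖v‖ ‖w‖`
(`ContinuousLinearMap.le_opNorm₂`). [folklore] -/
private theorem pin_abs_sub_bilin_le {G : E4 →L[ℝ] E4 →L[ℝ] ℝ} (hpin : ‖G - Minkowski.bilin‖ ≤ 1 / 2)
    (v w : E4) : |G v w - Minkowski.bilin v w| ≤ 1 / 2 * ‖v‖ * ‖w‖ := by
  have h1 := (G - Minkowski.bilin).le_opNorm₂ v w
  rw [sub_apply, sub_apply, Real.norm_eq_abs] at h1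
  exact h1.trans (by gcongr)

/-- Pythagoras for the time/space splitting of the Euclidean norm on `E4`:
`‖v‖² = (v⁰)² + ∑ᵢ (vⁱ)²`. [folklore] -/
private theorem pin_norm_sq_split (v : E4) : ‖v‖ ^ 2 = v 0 ^ 2 + ∑ i : Fin 3, v i.succ ^ 2 := by
  rw [EuclideanSpace.real_norm_sq_eq, Fin.sum_univ_succ]

/-- **Stub `stub_pinNondegenerate` of line `Sketch` (skeleton v5) for the crux `PhotonSphereChannels.TameCensorship`
(stmt-FinalStateConjecture-17431).** For a bilinear form `G` on `E4` with `‖G − η‖ ≤ ½`, every `w` satisfies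
`‖w‖ ≤ 2 ‖G w‖` (operator norm of the functional `G w : E4 →L[ℝ] ℝ`). Proof: test against the time-reflected
vector `z` (`z⁰ = −w⁰`, `zⁱ = wⁱ`): `‖z‖ = ‖w‖`, `η(w, z) = ‖w‖²`, hence
`G(w, z) ≥ η(w, z) − ½ ‖w‖ ‖z‖ = ½ ‖w‖²`, and `‖G w‖ ‖z‖ ≥ |G(w, z)|`. [folklore; O'Neill 1983, Ch. 2] -/
theorem stub_pinNondegenerate :
    ∀ (G : E4 →L[ℝ] E4 →L[ℝ] ℝ), ‖G - Minkowski.bilin‖ ≤ 1 / 2 → ∀ w : E4, ‖w‖ ≤ 2 * ‖G w‖ := by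
  intro G hpin w
  set e₀ : E4 := E4.basisVector 0 with he₀
  have he₀0 : e₀ 0 = 1 := by simp [he₀]
  -- the time-reflected vector `z = w − 2 w⁰ ∂₀`
  obtain ⟨z, hz⟩ : ∃ v : E4, v = w - (2 * w 0) • e₀ := ⟨_, rfl⟩
  have hz0 : z 0 = -w 0 := by
    simp only [hz, PiLp.sub_apply, PiLp.smul_apply, smul_eq_mul, he₀0]
    ring
  have hzi : ∀ i : Fin 3, z i.succ = w i.succ := by
    intro i
    simp [hz, he₀, Fin.succ_ne_zero]
  have hnorm : ‖z‖ = ‖w‖ := by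
    have h : ‖z‖ ^ 2 = ‖w‖ ^ 2 := by
      rw [pin_norm_sq_split z, pin_norm_sq_split w, hz0, neg_sq]
      simp only [hzi]
    exact (pow_left_inj₀ (norm_nonneg z) (norm_nonneg w) two_ne_zero).1 h
  -- `η(w, z) = ‖w‖²`
  have hη : Minkowski.bilin w z = ‖w‖ ^ 2 := by
    rw [Minkowski.bilin_apply, pin_norm_sq_split w, hz0]
    simp only [hzi, pow_two]
    ring
  -- the pin gives `G(w, z) ≥ ½ ‖w‖²`
  have hG : 1 / 2 * ‖w‖ * ‖w‖ ≤ G w z := by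
    have h1 := pin_abs_sub_bilin_le hpin w z
    rw [hη, hnorm, pow_two] at h1
    linarith [(abs_le.1 h1).1]
  -- the operator norm gives `G(w, z) ≤ ‖G w‖ ‖z‖ = ‖G w‖ ‖w‖`
  have hop : G w z ≤ ‖G w‖ * ‖w‖ := by
    have h1 := (G w).le_opNorm z
    rw [Real.norm_eq_abs, hnorm] at h1
    exact (le_abs_self _).trans h1
  by_cases hw : w = 0
  · simp [hw]
  · have hwpos : 0 < ‖w‖ := norm_pos_iff.2 hw
    have h2 : 1 / 2 * ‖w‖ ≤ ‖G w‖ := le_of_mul_le_mul_right (hG.trans hop) hwpos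
    linarith

end Summit.FinalStateConjecture.FinalStateConjecture.Theorems.PhotonSphereChannels.TameCensorshipUnwind

end
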